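import Mathlib.Topology.Algebra.Module.Basic
import Literature.NumberTheory.Automorphic.CompletedCohomologyPoints
import HarnessLib

/-!
# Completed cohomology as a representation of the `p`-adic group

Topic `NumberTheory/Automorphic`, namespace `Literature.NumberTheory.Automorphic`; continues
`CompletedCohomology` (towers `T : LevelTower 𝒢`, `H̃^i(k/ϖ^t) = completedCohomologyMod`,
`H̃^i = completedCohomology k ι T ϖ i = lim_t colim_s H^i(X_{K(s)}, k/ϖ^t)`), which deliberately left
out "the `G(ℚ_p)`-action on `H̃^i` and continuity".  This file supplies them, i.e. the structure by
which completed cohomology "admits a representation of the `p`-adic group" ([CalegariEmerton2011,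
Introduction and §1.5]: `H̃^•` inherits an action "not just of `G_0`, but of the entire `p`-adic
group `G(ℚ_p)`"; [Emerton2006, §2.2, Lemma 2.2.10 and Thm. 2.2.11 (i)]: the `G = G(F_𝔭)`-action on
`H̃^n(K^p, 𝒱)`), in the generality of an arbitrary tower of levels:

* `ArithmeticQuotient.ConjInto g L' L` (`g⁻¹ L' g ⊆ L`) and the **right translation**
  `ArithmeticQuotient.translateQuot g : 𝒢 ⧸ L' → 𝒢 ⧸ L`, `x L' ↦ x g L`; on coefficients
  `translateHom` (`f ↦ (x L' ↦ f (x g L))`, a morphism of `Γ`-representations since left and right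
  multiplication commute) and on cohomology `cohomologyTranslate : H^i(X_L, M) → H^i(X_{L'}, M)` —
  for `g = 1` this is the pull-back `cohomologyPullback` (`translateHom_one`), and
  `translate_g ≫ translate_{g'} = translate_{g' g}` (`translateHom_comp`);
* `LevelTower.IsContinuousAt T g` (every `K(s)` contains `g⁻¹ K(s') g` for some `s'`) and the
  subgroup `LevelTower.normalizer T` of the `g` with `g` and `g⁻¹` continuous — the elements of `𝒢`
  for which conjugation is a homeomorphism of the group topology having the `K(s)` as a basis of
  neighbourhoods of `1`; for the tower `Kᵖ K_p(p^s)` of `GL_n` over a number field it contains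
  `GL_n(K_v)`, `v ∣ p` (`CompletedCohomologyActionGL`);
* `completedCohomologyModRep k ι T ϖ i t : Representation k T.normalizer (H̃^i(k/ϖ^t))`, the action
  `g • [c] = [translate_g c]` on the direct limit (independent of the auxiliary level,
  `completedCohomologyModRep_apply_of`), compatible with the reductions `k/ϖ^{t+1} → k/ϖ^t`
  (`completedCohomologyModReduce_rep`), whence `completedCohomologyRep` on `H̃^i`;
* **`CompletedCohomology k ι T ϖ i`**, the type of Emerton's completed cohomology `H̃^i` (the
  carrier of the submodule `completedCohomology k ι T ϖ i` of compatible sequences), with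
  `CompletedCohomology.rep : Representation k T.normalizer (CompletedCohomology k ι T ϖ i)` and its
  **inverse-limit topology**: the `H̃^i(k/ϖ^t)` are given the discrete topology and `H̃^i ⊆ Π_t
  H̃^i(k/ϖ^t)` the subspace topology (the "projective limit topology" of [CalegariEmerton2011,
  Thm. 1.1]); it is a Hausdorff topological `k`-module in which the kernels of the projections
  `proj t : H̃^i → H̃^i(k/ϖ^t)` form a basis of open neighbourhoods of `0`
  (`CompletedCohomology.nhds_zero_hasBasis`), and every `ρ(g)` and every Hecke operator
  `completedHecke` is continuous (`continuous_rep`, `continuous_completedHecke`).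

NOT here: `ϖ`-adic completeness of `H̃^i` and the comparison of the inverse-limit topology with the
`ϖ`-adic one, admissibility / finiteness over `ℤ_p[[G_0]]` ([CalegariEmerton2011, Thm. 1.1],
[Emerton2006, Thm. 2.2.11]), completed homology, and the commutation of `ρ(g)` with the Hecke
operators `completedHecke` (a double-coset bijectivity condition, cf. `HeckeTowerCompatibility`).

## References

* F. Calegari, M. Emerton, *Completed cohomology — a survey*, in: Non-abelian fundamental groups
  and Iwasawa theory, LMS Lecture Note Ser. 393 (2012), 239–257, §1.1, §1.5 [CalegariEmerton2011].
* M. Emerton, *On the interpolation of systems of eigenvalues attached to automorphic Hecke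
  eigenforms*, Invent. Math. 164 (2006), 1–84, §2.2 [Emerton2006].
-/

noncomputable section

open CategoryTheory Topology Filter

universe u

namespace Literature.NumberTheory.Automorphic

/-! ### Right translation between levels -/

namespace ArithmeticQuotient

section Translate

variable {𝒢 : Type u} [Group 𝒢] {L L' L'' : Subgroup 𝒢}

/-- `ConjInto g L' L`: **`g⁻¹ L' g ⊆ L`**, the condition under which right translation by `g`,
`x L' ↦ x g L`, is well defined on cosets (equivalently `L' ⊆ g L g⁻¹`). [folklore] -/
def ConjInto (g : 𝒢) (L' L : Subgroup 𝒢) : Prop :=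
  ∀ x ∈ L', g⁻¹ * x * g ∈ L

/-- `ConjInto 1 L' L ↔ L' ≤ L`. [folklore] -/
@[simp]
theorem conjInto_one_iff : ConjInto (1 : 𝒢) L' L ↔ L' ≤ L := by
  simp [ConjInto, SetLike.le_def]

/-- `ConjInto g L L` for `g ∈ L`. [folklore] -/
theorem conjInto_of_mem {g : 𝒢} (hg : g ∈ L) : ConjInto g L L :=
  fun _ hx => L.mul_mem (L.mul_mem (L.inv_mem hg) hx) hg

/-- Shrinking the source level preserves `ConjInto`. [folklore] -/
theorem ConjInto.mono_left {g : 𝒢} (h : ConjInto g L' L) (h' : L'' ≤ L') : ConjInto g L'' L :=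
  fun x hx => h x (h' hx)

/-- Enlarging the target level preserves `ConjInto`. [folklore] -/
theorem ConjInto.mono_right {g : 𝒢} (h : ConjInto g L' L) (h' : L ≤ L'') : ConjInto g L' L'' :=
  fun x hx => h' (h x hx)

/-- `ConjInto` is multiplicative: `g⁻¹ L'' g ⊆ L'` and `g'⁻¹ L' g' ⊆ L` give
`(g g')⁻¹ L'' (g g') ⊆ L`. [folklore] -/
theorem ConjInto.mul {g g' : 𝒢} (h : ConjInto g L'' L') (h' : ConjInto g' L' L) :
    ConjInto (g * g') L'' L := by
  intro x hx
  have := h' _ (h x hx)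
  simpa only [mul_inv_rev, mul_assoc] using this

/-- **Right translation by `g` on cosets**, `x L' ↦ x g L`, for `g⁻¹ L' g ⊆ L`. [folklore] -/
def translateQuot (g : 𝒢) (h : ConjInto g L' L) : 𝒢 ⧸ L' → 𝒢 ⧸ L :=
  Quotient.map' (· * g) fun x y hxy => by
    rw [QuotientGroup.leftRel_apply] at hxy ⊢
    simpa only [mul_inv_rev, mul_assoc] using h _ hxy

/-- `translateQuot g (x L') = x g L` (definitional). [folklore] -/
@[simp]
theorem translateQuot_mk (g : 𝒢) (h : ConjInto g L' L) (x : 𝒢) :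
    translateQuot g h (x : 𝒢 ⧸ L') = ((x * g : 𝒢) : 𝒢 ⧸ L) :=
  rfl

/-- Right translation commutes with the left `𝒢`-action on cosets. [folklore] -/
theorem translateQuot_smul (g : 𝒢) (h : ConjInto g L' L) (a : 𝒢) (c : 𝒢 ⧸ L') :
    translateQuot g h (a • c) = a • translateQuot g h c := by
  induction c using QuotientGroup.induction_on with
  | H x => simp only [MulAction.Quotient.smul_coe, smul_eq_mul, translateQuot_mk, mul_assoc]

/-- Right translation by `1` is the projection `𝒢 ⧸ L' → 𝒢 ⧸ L` (`L' ≤ L`). [folklore] -/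
theorem translateQuot_one (h : ConjInto (1 : 𝒢) L' L) (h₁ : L' ≤ L) (c : 𝒢 ⧸ L') :
    translateQuot 1 h c = Subgroup.quotientMapOfLE h₁ c := by
  induction c using QuotientGroup.induction_on with
  | H x => rw [translateQuot_mk, mul_one, Subgroup.quotientMapOfLE_apply_mk]

/-- Right translations compose: `(x g' L') g L = x (g' g) L`. [folklore] -/
theorem translateQuot_translateQuot {g g' : 𝒢} (h : ConjInto g L' L) (h' : ConjInto g' L'' L')
    (h'' : ConjInto (g' * g) L'' L) (c : 𝒢 ⧸ L'') :
    translateQuot g h (translateQuot g' h' c) = translateQuot (g' * g) h'' c := by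
  induction c using QuotientGroup.induction_on with
  | H x => simp only [translateQuot_mk, mul_assoc]

end Translate

section TranslateRep

variable (k : Type u) [CommRing k] {Γ 𝒢 : Type u} [Group Γ] [Group 𝒢]
variable (ι : Γ →* 𝒢) {L L' L'' : Subgroup 𝒢} (M : Type u) [AddCommGroup M] [Module k M]

/-- **Right translation by `g` on coefficients**: for `g⁻¹ L' g ⊆ L`, the morphism of
`Γ`-representations `Fun(𝒢 ⧸ L, M) ⟶ Fun(𝒢 ⧸ L', M)`, `f ↦ (x L' ↦ f (x g L))` (left translation by
`Γ` and right translation by `g` commute).  For `g = 1` this is `pullbackHom` (`translateHom_one`).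
This is the map inducing the action of the `p`-adic group on the cohomology of the tower
[Emerton2006, §2.2, proof of Lemma 2.2.10]. [cite: Emerton2006, §2.2, Lemma 2.2.10] -/
def translateHom (g : 𝒢) (h : ConjInto g L' L) : coeffRep k ι L M ⟶ coeffRep k ι L' M :=
  Rep.ofHom ⟨LinearMap.funLeft k M (translateQuot g h), fun γ =>
    LinearMap.ext fun f => funext fun c => by
      simp [translateQuot_smul]⟩

/-- Unfolding lemma for `translateHom`: `(translate_g f)(c) = f (c g)`. [folklore] -/
@[simp]
theorem translateHom_apply (g : 𝒢) (h : ConjInto g L' L) (f : (𝒢 ⧸ L) → M) (c : 𝒢 ⧸ L') :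
    (translateHom k ι M g h).hom f c = f (translateQuot g h c) :=
  rfl

/-- Right translation by `1` is the pull-back along `L' ≤ L`. [folklore] -/
theorem translateHom_one (h : ConjInto (1 : 𝒢) L' L) (h₁ : L' ≤ L) :
    translateHom k ι M 1 h = pullbackHom k ι M h₁ := by
  refine Rep.hom_ext (Representation.IntertwiningMap.ext (LinearMap.ext fun f => funext fun c => ?_))
  change f (translateQuot 1 h c) = f (Subgroup.quotientMapOfLE h₁ c)
  rw [translateQuot_one h h₁]

/-- Right translation by an element equal to `1` is the pull-back (a form of `translateHom_one`
avoiding dependent rewriting, e.g. for `g = ↑(1 : H)`). [folklore] -/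
theorem translateHom_eq_pullbackHom {g : 𝒢} (hg : g = 1) (h : ConjInto g L' L) (h₁ : L' ≤ L) :
    translateHom k ι M g h = pullbackHom k ι M h₁ := by
  subst hg
  exact translateHom_one k ι M h h₁

/-- Right translations compose contravariantly on coefficients:
`translate_g ≫ translate_{g'} = translate_{g' g}` (`Fun(𝒢 ⧸ L) → Fun(𝒢 ⧸ L') → Fun(𝒢 ⧸ L'')`).
[folklore] -/
theorem translateHom_comp {g g' : 𝒢} (h : ConjInto g L' L) (h' : ConjInto g' L'' L')
    (h'' : ConjInto (g' * g) L'' L) :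
    translateHom k ι M g h ≫ translateHom k ι M g' h' = translateHom k ι M (g' * g) h'' := by
  refine Rep.hom_ext (Representation.IntertwiningMap.ext (LinearMap.ext fun f => funext fun c => ?_))
  change f (translateQuot g h (translateQuot g' h' c)) = f (translateQuot (g' * g) h'' c)
  rw [translateQuot_translateQuot h h' h'']

/-- Right translation followed by a pull-back is a right translation. [folklore] -/
theorem translateHom_comp_pullbackHom {g : 𝒢} (h : ConjInto g L' L) (h₁ : L'' ≤ L')
    (h'' : ConjInto g L'' L) :
    translateHom k ι M g h ≫ pullbackHom k ι M h₁ = translateHom k ι M g h'' := by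
  refine Rep.hom_ext (Representation.IntertwiningMap.ext (LinearMap.ext fun f => funext fun c => ?_))
  induction c using QuotientGroup.induction_on
  rfl

/-- A pull-back followed by a right translation is a right translation. [folklore] -/
theorem pullbackHom_comp_translateHom {g : 𝒢} (h₁ : L' ≤ L) (h : ConjInto g L'' L')
    (h'' : ConjInto g L'' L) :
    pullbackHom k ι M h₁ ≫ translateHom k ι M g h = translateHom k ι M g h'' := by
  refine Rep.hom_ext (Representation.IntertwiningMap.ext (LinearMap.ext fun f => funext fun c => ?_))
  induction c using QuotientGroup.induction_on
  rfl

variable {k M} {M' : Type u} [AddCommGroup M'] [Module k M']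

/-- Right translation commutes with change of coefficients. [folklore] -/
theorem translateHom_comp_coeffHom {g : 𝒢} (h : ConjInto g L' L) (φ : M →ₗ[k] M') :
    translateHom k ι M g h ≫ coeffHom ι L' φ = coeffHom ι L φ ≫ translateHom k ι M' g h :=
  Rep.hom_ext (Representation.IntertwiningMap.ext (LinearMap.ext fun _ => rfl))

variable (k M)

/-- **Right translation by `g` in cohomology**, `H^i(X_L, M) → H^i(X_{L'}, M)` for `g⁻¹ L' g ⊆ L`
(functoriality of group cohomology in the coefficients along `translateHom`); for `g = 1` the
pull-back along the covering `X_{L'} → X_L`.  These maps induce the action of the `p`-adic group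
on completed cohomology [Emerton2006, §2.2, Lemma 2.2.10]. [cite: Emerton2006, §2.2, Lemma 2.2.10] -/
abbrev cohomologyTranslate (g : 𝒢) (h : ConjInto g L' L) (i : ℕ) :
    cohomology k ι L M i ⟶ cohomology k ι L' M i :=
  groupCohomology.map (MonoidHom.id Γ) (translateHom k ι M g h) i

/-- In cohomology, right translation by (an element equal to) `1` is the pull-back. [folklore] -/
theorem cohomologyTranslate_eq_cohomologyPullback {g : 𝒢} (hg : g = 1) (h : ConjInto g L' L)
    (h₁ : L' ≤ L) (i : ℕ) :
    cohomologyTranslate k ι M g h i = cohomologyPullback k ι M h₁ i := by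
  rw [cohomologyTranslate, cohomologyPullback, translateHom_eq_pullbackHom k ι M hg h h₁]

/-- In cohomology, right translations compose: `translate_g ≫ translate_{g'} = translate_{g' g}`.
[folklore] -/
theorem cohomologyTranslate_comp {g g' : 𝒢} (h : ConjInto g L' L) (h' : ConjInto g' L'' L')
    (h'' : ConjInto (g' * g) L'' L) (i : ℕ) :
    cohomologyTranslate k ι M g h i ≫ cohomologyTranslate k ι M g' h' i =
      cohomologyTranslate k ι M (g' * g) h'' i := by
  rw [cohomologyTranslate, cohomologyTranslate, ← groupCohomology.map_id_comp,
    translateHom_comp k ι M h h' h'']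

/-- In cohomology, right translation followed by pull-back is right translation. [folklore] -/
theorem cohomologyTranslate_comp_cohomologyPullback {g : 𝒢} (h : ConjInto g L' L) (h₁ : L'' ≤ L')
    (h'' : ConjInto g L'' L) (i : ℕ) :
    cohomologyTranslate k ι M g h i ≫ cohomologyPullback k ι M h₁ i =
      cohomologyTranslate k ι M g h'' i := by
  rw [cohomologyTranslate, cohomologyPullback, ← groupCohomology.map_id_comp,
    translateHom_comp_pullbackHom k ι M h h₁ h'']

/-- In cohomology, pull-back followed by right translation is right translation. [folklore] -/
theorem cohomologyPullback_comp_cohomologyTranslate {g : 𝒢} (h₁ : L' ≤ L) (h : ConjInto g L'' L')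
    (h'' : ConjInto g L'' L) (i : ℕ) :
    cohomologyPullback k ι M h₁ i ≫ cohomologyTranslate k ι M g h i =
      cohomologyTranslate k ι M g h'' i := by
  rw [cohomologyTranslate, cohomologyPullback, ← groupCohomology.map_id_comp,
    pullbackHom_comp_translateHom k ι M h₁ h h'']

variable {k M}

/-- In cohomology, right translation commutes with change of coefficients. [folklore] -/
theorem cohomologyTranslate_comp_cohomologyCoeffMap {g : 𝒢} (h : ConjInto g L' L)
    (φ : M →ₗ[k] M') (i : ℕ) :
    cohomologyTranslate k ι M g h i ≫ cohomologyCoeffMap ι L' φ i =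
      cohomologyCoeffMap ι L φ i ≫ cohomologyTranslate k ι M' g h i := by
  rw [cohomologyTranslate, cohomologyCoeffMap, ← groupCohomology.map_id_comp,
    translateHom_comp_coeffHom ι h φ, groupCohomology.map_id_comp]

end TranslateRep

end ArithmeticQuotient

/-! ### Elements acting continuously on a tower -/

namespace LevelTower

variable {𝒢 : Type u} [Group 𝒢] (T : LevelTower 𝒢)

/-- `g` is **continuous at the tower** `T`: every level `K(s)` contains `g⁻¹ K(s') g` for some
`s'`, i.e. conjugation `x ↦ g⁻¹ x g` is continuous at `1` for the group topology on `𝒢` having the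
`K(s)` as a basis of neighbourhoods of `1`.  For `K(s) = Kᵖ K_p(p^s)` every `g ∈ G(ℚ_p)` qualifies,
the `K_p(p^s)` being a neighbourhood basis of `1` in `G(ℚ_p)` [CalegariEmerton2011, §1.5].
[cite: CalegariEmerton2011, §1.5] -/
def IsContinuousAt (g : 𝒢) : Prop :=
  ∀ s : ℕ, ∃ s' : ℕ, ArithmeticQuotient.ConjInto g (T.level s') (T.level s)

variable {T}

/-- `1` is continuous at every tower. [folklore] -/
theorem isContinuousAt_one : T.IsContinuousAt 1 :=
  fun s => ⟨s, ArithmeticQuotient.conjInto_one_iff.2 le_rfl⟩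

/-- An element lying in every level is continuous at the tower. [folklore] -/
theorem isContinuousAt_of_forall_mem {g : 𝒢} (hg : ∀ s, g ∈ T.level s) : T.IsContinuousAt g :=
  fun s => ⟨s, ArithmeticQuotient.conjInto_of_mem (hg s)⟩

/-- Continuity at the tower is multiplicative. [folklore] -/
theorem IsContinuousAt.mul {g g' : 𝒢} (hg : T.IsContinuousAt g) (hg' : T.IsContinuousAt g') :
    T.IsContinuousAt (g * g') := by
  intro s
  obtain ⟨s₁, h₁⟩ := hg' s
  obtain ⟨s₂, h₂⟩ := hg s₁
  exact ⟨s₂, h₂.mul h₁⟩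

/-- The witness level may be taken beyond any given level. [folklore] -/
theorem IsContinuousAt.exists_ge {g : 𝒢} (hg : T.IsContinuousAt g) (s s₀ : ℕ) :
    ∃ s', s₀ ≤ s' ∧ ArithmeticQuotient.ConjInto g (T.level s') (T.level s) := by
  obtain ⟨s', h⟩ := hg s
  exact ⟨max s₀ s', le_max_left _ _, h.mono_left (T.level_le (le_max_right _ _))⟩

variable (T)

/-- **The normaliser of the tower** (up to cofinality): the subgroup of `g ∈ 𝒢` such that `g` and
`g⁻¹` are continuous at `T`, i.e. conjugation by `g` is a homeomorphism for the group topology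
defined by the `K(s)`.  This is the group that acts on the completed cohomology of the tower
(`completedCohomologyModRep`, `CompletedCohomology.rep`); for the tower `Kᵖ K_p(p^s)` of a
reductive group over `ℚ` it contains (the image of) `G(ℚ_p)` [CalegariEmerton2011, §1.5],
[Emerton2006, §2.2, Lemma 2.2.10]. [cite: CalegariEmerton2011, §1.5] -/
def normalizer : Subgroup 𝒢 where
  carrier := {g | T.IsContinuousAt g ∧ T.IsContinuousAt g⁻¹}
  one_mem' := ⟨isContinuousAt_one, by rw [inv_one]; exact isContinuousAt_one⟩
  mul_mem' hg hg' := ⟨hg.1.mul hg'.1, by rw [mul_inv_rev]; exact hg'.2.mul hg.2⟩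
  inv_mem' hg := ⟨hg.2, by rw [inv_inv]; exact hg.1⟩

variable {T}

/-- Membership in the normaliser of the tower (definitional). [folklore] -/
theorem mem_normalizer_iff {g : 𝒢} :
    g ∈ T.normalizer ↔ T.IsContinuousAt g ∧ T.IsContinuousAt g⁻¹ :=
  Iff.rfl

/-- An element of every level lies in the normaliser. [folklore] -/
theorem mem_normalizer_of_forall_mem {g : 𝒢} (hg : ∀ s, g ∈ T.level s) : g ∈ T.normalizer :=
  ⟨isContinuousAt_of_forall_mem hg, isContinuousAt_of_forall_mem fun s => (T.level s).inv_mem (hg s)⟩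

/-- A subgroup all of whose elements are continuous at the tower lies in its normaliser.
[folklore] -/
theorem le_normalizer_of_forall {H : Subgroup 𝒢} (hH : ∀ g ∈ H, T.IsContinuousAt g) :
    H ≤ T.normalizer :=
  fun _ hg => ⟨hH _ hg, hH _ (H.inv_mem hg)⟩

variable (T)

/-- A **witness level** for `g ∈ T.normalizer` at `s`: some `s'` with `g⁻¹ K(s') g ⊆ K(s)` (a
choice; nothing below depends on it, see `completedCohomologyModRep_apply_of`). [folklore] -/
def depth (g : T.normalizer) (s : ℕ) : ℕ :=
  Classical.choose (g.2.1 s)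

/-- The defining property of `depth`. [folklore] -/
theorem conjInto_depth (g : T.normalizer) (s : ℕ) :
    ArithmeticQuotient.ConjInto (g : 𝒢) (T.level (T.depth g s)) (T.level s) :=
  Classical.choose_spec (g.2.1 s)

end LevelTower

/-! ### The action on `H̃^i(k/ϖ^t)` and on `H̃^i` -/

section Action

variable (k : Type u) [CommRing k] {Γ 𝒢 : Type u} [Group Γ] [Group 𝒢]
variable (ι : Γ →* 𝒢) (T : LevelTower 𝒢) (ϖ : k)

/-- Right translation by `g` between two levels of the tower on `H^i(X_{K(s)}, k/ϖ^t)`. [folklore] -/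
abbrev towerTranslate (i t : ℕ) (g : 𝒢) {s s' : ℕ}
    (h : ArithmeticQuotient.ConjInto g (T.level s') (T.level s)) :
    towerCohomology k ι T ϖ i s t ⟶ towerCohomology k ι T ϖ i s' t :=
  ArithmeticQuotient.cohomologyTranslate k ι (modPow k ϖ t) g h i

/-- `towerTranslate` by (an element equal to) `1` is the pull-back of the tower. [folklore] -/
theorem towerTranslate_eq_towerPullback (i t : ℕ) {g : 𝒢} (hg : g = 1) {s s' : ℕ}
    (h : ArithmeticQuotient.ConjInto g (T.level s') (T.level s)) (hs : s ≤ s') :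
    towerTranslate k ι T ϖ i t g h = towerPullback k ι T ϖ i t hs :=
  ArithmeticQuotient.cohomologyTranslate_eq_cohomologyPullback k ι (modPow k ϖ t) hg h (T.level_le hs) i

/-- `towerTranslate`s compose. [folklore] -/
theorem towerTranslate_comp (i t : ℕ) {g g' : 𝒢} {s s' s'' : ℕ}
    (h : ArithmeticQuotient.ConjInto g (T.level s') (T.level s))
    (h' : ArithmeticQuotient.ConjInto g' (T.level s'') (T.level s'))
    (h'' : ArithmeticQuotient.ConjInto (g' * g) (T.level s'') (T.level s)) :
    towerTranslate k ι T ϖ i t g h ≫ towerTranslate k ι T ϖ i t g' h' =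
      towerTranslate k ι T ϖ i t (g' * g) h'' :=
  ArithmeticQuotient.cohomologyTranslate_comp k ι (modPow k ϖ t) h h' h'' i

/-- `towerTranslate` followed by a pull-back of the tower. [folklore] -/
theorem towerTranslate_comp_towerPullback (i t : ℕ) {g : 𝒢} {s s' s'' : ℕ}
    (h : ArithmeticQuotient.ConjInto g (T.level s') (T.level s)) (hs : s' ≤ s'')
    (h'' : ArithmeticQuotient.ConjInto g (T.level s'') (T.level s)) :
    towerTranslate k ι T ϖ i t g h ≫ towerPullback k ι T ϖ i t hs = towerTranslate k ι T ϖ i t g h'' :=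
  ArithmeticQuotient.cohomologyTranslate_comp_cohomologyPullback k ι (modPow k ϖ t) h (T.level_le hs)
    h'' i

/-- A pull-back of the tower followed by `towerTranslate`. [folklore] -/
theorem towerPullback_comp_towerTranslate (i t : ℕ) {g : 𝒢} {s s' s'' : ℕ} (hs : s ≤ s')
    (h : ArithmeticQuotient.ConjInto g (T.level s'') (T.level s'))
    (h'' : ArithmeticQuotient.ConjInto g (T.level s'') (T.level s)) :
    towerPullback k ι T ϖ i t hs ≫ towerTranslate k ι T ϖ i t g h = towerTranslate k ι T ϖ i t g h'' :=
  ArithmeticQuotient.cohomologyPullback_comp_cohomologyTranslate k ι (modPow k ϖ t) (T.level_le hs) h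
    h'' i

/-- At a fixed level, right translation commutes with the reduction of coefficients. [folklore] -/
theorem towerTranslate_comp_towerReduce (i t : ℕ) (g : 𝒢) {s s' : ℕ}
    (h : ArithmeticQuotient.ConjInto g (T.level s') (T.level s)) :
    towerTranslate k ι T ϖ i (t + 1) g h ≫ towerReduce k ι T ϖ i s' t =
      towerReduce k ι T ϖ i s t ≫ towerTranslate k ι T ϖ i t g h :=
  ArithmeticQuotient.cohomologyTranslate_comp_cohomologyCoeffMap ι h (modPowReduce k ϖ t) i

/-- The structure map of the direct limit absorbs pull-backs: `[pullback c] = [c]`. [folklore] -/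
theorem toCompletedCohomologyMod_towerPullback (i t : ℕ) {s s' : ℕ} (hs : s ≤ s')
    (c : towerCohomology k ι T ϖ i s t) :
    toCompletedCohomologyMod k ι T ϖ i s' t ((towerPullback k ι T ϖ i t hs).hom c) =
      toCompletedCohomologyMod k ι T ϖ i s t c :=
  Module.DirectLimit.of_f (G := fun s => towerCohomology k ι T ϖ i s t)
    (f := towerTransition k ι T ϖ i t) (hij := hs) (x := c)

/-- The class of `translate_g c` in `H̃^i(k/ϖ^t)` does not depend on the target level. [folklore] -/
theorem toCompletedCohomologyMod_towerTranslate_eq (i t : ℕ) (g : 𝒢) {s s₁ s₂ : ℕ}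
    (h₁ : ArithmeticQuotient.ConjInto g (T.level s₁) (T.level s))
    (h₂ : ArithmeticQuotient.ConjInto g (T.level s₂) (T.level s))
    (c : towerCohomology k ι T ϖ i s t) :
    toCompletedCohomologyMod k ι T ϖ i s₁ t ((towerTranslate k ι T ϖ i t g h₁).hom c) =
      toCompletedCohomologyMod k ι T ϖ i s₂ t ((towerTranslate k ι T ϖ i t g h₂).hom c) := by
  have h₃ : ArithmeticQuotient.ConjInto g (T.level (max s₁ s₂)) (T.level s) :=
    h₁.mono_left (T.level_le (le_max_left _ _))
  rw [← toCompletedCohomologyMod_towerPullback k ι T ϖ i t (le_max_left s₁ s₂),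
    ← toCompletedCohomologyMod_towerPullback k ι T ϖ i t (le_max_right s₁ s₂)
      ((towerTranslate k ι T ϖ i t g h₂).hom c),
    ← ModuleCat.comp_apply, ← ModuleCat.comp_apply,
    towerTranslate_comp_towerPullback k ι T ϖ i t h₁ (le_max_left s₁ s₂) h₃,
    towerTranslate_comp_towerPullback k ι T ϖ i t h₂ (le_max_right s₁ s₂) h₃]

/-- The level-`s` component of the action of `g ∈ T.normalizer` on `H̃^i(k/ϖ^t)`:
`c ↦ [translate_g c]` (through the witness level `T.depth g s`). [folklore] -/
def translateToMod (i t : ℕ) (g : T.normalizer) (s : ℕ) :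
    towerCohomology k ι T ϖ i s t →ₗ[k] completedCohomologyMod k ι T ϖ i t :=
  toCompletedCohomologyMod k ι T ϖ i (T.depth g s) t ∘ₗ
    (towerTranslate k ι T ϖ i t (g : 𝒢) (T.conjInto_depth g s)).hom

/-- `translateToMod` computed through any admissible level. [folklore] -/
theorem translateToMod_eq (i t : ℕ) (g : T.normalizer) {s s' : ℕ}
    (h : ArithmeticQuotient.ConjInto (g : 𝒢) (T.level s') (T.level s))
    (c : towerCohomology k ι T ϖ i s t) :
    translateToMod k ι T ϖ i t g s c =
      toCompletedCohomologyMod k ι T ϖ i s' t ((towerTranslate k ι T ϖ i t (g : 𝒢) h).hom c) :=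
  toCompletedCohomologyMod_towerTranslate_eq k ι T ϖ i t (g : 𝒢) (T.conjInto_depth g s) h c

/-- The components `translateToMod` are compatible with the pull-backs of the tower. [folklore] -/
theorem translateToMod_towerTransition (i t : ℕ) (g : T.normalizer) {s s' : ℕ} (hs : s ≤ s')
    (c : towerCohomology k ι T ϖ i s t) :
    translateToMod k ι T ϖ i t g s' (towerTransition k ι T ϖ i t s s' hs c) =
      translateToMod k ι T ϖ i t g s c := by
  obtain ⟨s₁, h₁⟩ := g.2.1 s'
  have h₂ : ArithmeticQuotient.ConjInto (g : 𝒢) (T.level s₁) (T.level s) :=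
    h₁.mono_right (T.level_le hs)
  rw [translateToMod_eq k ι T ϖ i t g h₁, translateToMod_eq k ι T ϖ i t g h₂]
  change toCompletedCohomologyMod k ι T ϖ i s₁ t
      ((towerPullback k ι T ϖ i t hs ≫ towerTranslate k ι T ϖ i t (g : 𝒢) h₁).hom c) = _
  rw [towerPullback_comp_towerTranslate k ι T ϖ i t hs h₁ h₂]

/-- The action of `g ∈ T.normalizer` on `H̃^i(k/ϖ^t) = colim_s H^i(X_{K(s)}, k/ϖ^t)` as a linear map
(`Module.DirectLimit.lift` of the `translateToMod`). [folklore] -/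
def completedCohomologyModAct (i t : ℕ) (g : T.normalizer) :
    Module.End k (completedCohomologyMod k ι T ϖ i t) :=
  Module.DirectLimit.lift k ℕ (fun s => towerCohomology k ι T ϖ i s t) (towerTransition k ι T ϖ i t)
    (fun s => translateToMod k ι T ϖ i t g s)
    fun _ _ hs c => translateToMod_towerTransition k ι T ϖ i t g hs c

/-- **The action on generators**: `g • [c] = [translate_g c]` for `c ∈ H^i(X_{K(s)}, k/ϖ^t)` and ANY
level `s'` with `g⁻¹ K(s') g ⊆ K(s)`. [folklore] -/
theorem completedCohomologyModAct_of (i t : ℕ) (g : T.normalizer) {s s' : ℕ}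
    (h : ArithmeticQuotient.ConjInto (g : 𝒢) (T.level s') (T.level s))
    (c : towerCohomology k ι T ϖ i s t) :
    completedCohomologyModAct k ι T ϖ i t g (toCompletedCohomologyMod k ι T ϖ i s t c) =
      toCompletedCohomologyMod k ι T ϖ i s' t ((towerTranslate k ι T ϖ i t (g : 𝒢) h).hom c) := by
  rw [completedCohomologyModAct, toCompletedCohomologyMod, Module.DirectLimit.lift_of]
  exact translateToMod_eq k ι T ϖ i t g h c

/-- `1` acts trivially on `H̃^i(k/ϖ^t)`. [folklore] -/
theorem completedCohomologyModAct_one (i t : ℕ) :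
    completedCohomologyModAct k ι T ϖ i t 1 = 1 := by
  refine Module.DirectLimit.hom_ext fun s => LinearMap.ext fun c => ?_
  change completedCohomologyModAct k ι T ϖ i t 1 (toCompletedCohomologyMod k ι T ϖ i s t c) =
    toCompletedCohomologyMod k ι T ϖ i s t c
  have h₁ : ArithmeticQuotient.ConjInto ((1 : T.normalizer) : 𝒢) (T.level s) (T.level s) :=
    ArithmeticQuotient.conjInto_one_iff.2 le_rfl
  rw [completedCohomologyModAct_of k ι T ϖ i t 1 h₁ c,
    towerTranslate_eq_towerPullback k ι T ϖ i t (g := ((1 : T.normalizer) : 𝒢)) (Subgroup.coe_one _) h₁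
      le_rfl,
    toCompletedCohomologyMod_towerPullback]

/-- The action on `H̃^i(k/ϖ^t)` is multiplicative. [folklore] -/
theorem completedCohomologyModAct_mul (i t : ℕ) (g g' : T.normalizer) :
    completedCohomologyModAct k ι T ϖ i t (g * g') =
      completedCohomologyModAct k ι T ϖ i t g * completedCohomologyModAct k ι T ϖ i t g' := by
  refine Module.DirectLimit.hom_ext fun s => LinearMap.ext fun c => ?_
  obtain ⟨s₁, h₁⟩ := g'.2.1 s
  obtain ⟨s₂, h₂⟩ := g.2.1 s₁
  change completedCohomologyModAct k ι T ϖ i t (g * g') (toCompletedCohomologyMod k ι T ϖ i s t c) =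
    completedCohomologyModAct k ι T ϖ i t g
      (completedCohomologyModAct k ι T ϖ i t g' (toCompletedCohomologyMod k ι T ϖ i s t c))
  rw [completedCohomologyModAct_of k ι T ϖ i t (g * g') (s' := s₂)
      (show ArithmeticQuotient.ConjInto ((g : 𝒢) * (g' : 𝒢)) _ _ from h₂.mul h₁) c,
    completedCohomologyModAct_of k ι T ϖ i t g' h₁, completedCohomologyModAct_of k ι T ϖ i t g h₂,
    ← ModuleCat.comp_apply, towerTranslate_comp k ι T ϖ i t h₁ h₂ (h₂.mul h₁)]
  rfl

/-- **`H̃^i(k/ϖ^t)` as a representation of the normaliser of the tower**: `g • [c] = [translate_g c]`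
— the action of the `p`-adic group on `colim_{K_p} H^i(Y(K_p Kᵖ), 𝒱/ϖ^t)` of
[Emerton2006, §2.2, Lemma 2.2.10] (trivial local system). [cite: Emerton2006, §2.2, Lemma 2.2.10] -/
def completedCohomologyModRep (i t : ℕ) :
    Representation k T.normalizer (completedCohomologyMod k ι T ϖ i t) where
  toFun := completedCohomologyModAct k ι T ϖ i t
  map_one' := completedCohomologyModAct_one k ι T ϖ i t
  map_mul' := completedCohomologyModAct_mul k ι T ϖ i t

/-- `completedCohomologyModRep` on generators (through any admissible level). [folklore] -/
theorem completedCohomologyModRep_apply_of (i t : ℕ) (g : T.normalizer) {s s' : ℕ}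
    (h : ArithmeticQuotient.ConjInto (g : 𝒢) (T.level s') (T.level s))
    (c : towerCohomology k ι T ϖ i s t) :
    completedCohomologyModRep k ι T ϖ i t g (toCompletedCohomologyMod k ι T ϖ i s t c) =
      toCompletedCohomologyMod k ι T ϖ i s' t ((towerTranslate k ι T ϖ i t (g : 𝒢) h).hom c) :=
  completedCohomologyModAct_of k ι T ϖ i t g h c

/-- The action on `H̃^i(k/ϖ^•)` commutes with the reductions `H̃^i(k/ϖ^{t+1}) → H̃^i(k/ϖ^t)`.
[folklore] -/
theorem completedCohomologyModReduce_rep (i t : ℕ) (g : T.normalizer)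
    (x : completedCohomologyMod k ι T ϖ i (t + 1)) :
    completedCohomologyModReduce k ι T ϖ i t (completedCohomologyModRep k ι T ϖ i (t + 1) g x) =
      completedCohomologyModRep k ι T ϖ i t g (completedCohomologyModReduce k ι T ϖ i t x) := by
  induction x using Module.DirectLimit.induction_on with
  | ih s c =>
    obtain ⟨s', h⟩ := g.2.1 s
    change completedCohomologyModReduce k ι T ϖ i t
        (completedCohomologyModRep k ι T ϖ i (t + 1) g (toCompletedCohomologyMod k ι T ϖ i s (t + 1) c)) =
      completedCohomologyModRep k ι T ϖ i t g
        (completedCohomologyModReduce k ι T ϖ i t (toCompletedCohomologyMod k ι T ϖ i s (t + 1) c))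
    rw [completedCohomologyModRep_apply_of k ι T ϖ i (t + 1) g h, completedCohomologyModReduce_of,
      completedCohomologyModReduce_of, completedCohomologyModRep_apply_of k ι T ϖ i t g h,
      ← ModuleCat.comp_apply, ← ModuleCat.comp_apply, towerTranslate_comp_towerReduce]

/-- **Completed cohomology `H̃^i` as a representation of the normaliser of the tower** (the
compatible family of the `completedCohomologyModRep`): the action of the `p`-adic group on
`H̃^i = lim_t colim_s H^i(X_{K(s)}, k/ϖ^t)` [CalegariEmerton2011, §1.5], [Emerton2006, §2.2,
Lemma 2.2.10, Thm. 2.2.11 (i)]. [cite: Emerton2006, §2.2, Lemma 2.2.10] -/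
def completedCohomologyRep (i : ℕ) : Representation k T.normalizer (completedCohomology k ι T ϖ i) where
  toFun g :=
    { toFun := fun x => ⟨fun t => completedCohomologyModRep k ι T ϖ i t g (x.1 t), fun t => by
        rw [completedCohomologyModReduce_rep, x.2 t]⟩
      map_add' := fun x y => by
        ext t
        simp
      map_smul' := fun r x => by
        ext t
        simp }
  map_one' := by
    refine LinearMap.ext fun x => Subtype.ext (funext fun t => ?_)
    simp
  map_mul' g g' := by
    refine LinearMap.ext fun x => Subtype.ext (funext fun t => ?_)
    simp

/-- `completedCohomologyRep` followed by the projection to `H̃^i(k/ϖ^t)` (definitional). [folklore] -/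
@[simp]
theorem proj_completedCohomologyRep (i t : ℕ) (g : T.normalizer) (x : completedCohomology k ι T ϖ i) :
    CompletedCohomology.proj k ι T ϖ i t (completedCohomologyRep k ι T ϖ i g x) =
      completedCohomologyModRep k ι T ϖ i t g (CompletedCohomology.proj k ι T ϖ i t x) :=
  rfl

end Action

/-! ### The type `CompletedCohomology`: topology and action -/

section CompletedType

variable (k : Type u) [CommRing k] {Γ 𝒢 : Type u} [Group Γ] [Group 𝒢]
variable (ι : Γ →* 𝒢) (T : LevelTower 𝒢) (ϖ : k)

/-- The finite stages `H̃^i(k/ϖ^t)` (`ϖ^t`-torsion modules) carry the DISCRETE topology.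
[cite: CalegariEmerton2011, §1.1, Thm. 1.1] -/
instance completedCohomologyMod.instTopologicalSpace (i t : ℕ) :
    TopologicalSpace (completedCohomologyMod k ι T ϖ i t) :=
  ⊥

/-- The topology on `H̃^i(k/ϖ^t)` is discrete (by definition). [folklore] -/
instance completedCohomologyMod.instDiscreteTopology (i t : ℕ) :
    DiscreteTopology (completedCohomologyMod k ι T ϖ i t) :=
  ⟨rfl⟩

/-- Scalar multiplication on the discrete `H̃^i(k/ϖ^t)` is by continuous maps. [folklore] -/
instance completedCohomologyMod.instContinuousConstSMul (i t : ℕ) :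
    ContinuousConstSMul k (completedCohomologyMod k ι T ϖ i t) :=
  ⟨fun _ => continuous_of_discreteTopology⟩

/-- **Emerton's completed cohomology `H̃^i` of the tower `T`** as a type: the `k`-module of
compatible sequences `H̃^i = lim_t colim_s H^i(X_{K(s)}, k/ϖ^t)` — the carrier of the submodule
`completedCohomology k ι T ϖ i` of `Π_t H̃^i(k/ϖ^t)` ([CalegariEmerton2011, §1.1]:
`H̃^• := lim_s colim_r H^•(X_r, ℤ/p^s)`; [Emerton2006, §2.2]: `H̃^n(K^p, 𝒱_{W₀}) :=
lim_s colim_{K_p} H^n(Y(K_p K^p), 𝒱_{W₀}/p^s)`).  As a subspace of the product of the discrete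
`H̃^i(k/ϖ^t)` it carries the inverse-limit topology (Hausdorff, a topological `k`-module;
`nhds_zero_hasBasis`), and it carries the representation `CompletedCohomology.rep` of the
normaliser `T.normalizer` of the tower — for `Γ = G(ℚ) → 𝒢 = G(𝔸_f)` and `K(s) = Kᵖ K_p(p^s)`
the action of the `p`-adic group `G(ℚ_p)` on `H̃^i(Kᵖ)` [CalegariEmerton2011, §1.5],
[Emerton2006, §2.2, Thm. 2.2.11 (i)] — by continuous maps (`continuous_rep`), besides the
Hecke operators `completedHecke` of `CompletedCohomology` (`continuous_completedHecke`).
[cite: CalegariEmerton2011, §1.1 and §1.5] -/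
abbrev CompletedCohomology (i : ℕ) : Type u :=
  completedCohomology k ι T ϖ i

namespace CompletedCohomology

variable (i : ℕ)

/-- **The action of the normaliser of the tower on `H̃^i`** (`completedCohomologyRep` on the type
`CompletedCohomology`): `(g • x)_t = g • x_t` with `g • [c] = [translate_g c]`.
[cite: Emerton2006, §2.2, Lemma 2.2.10] -/
abbrev rep : Representation k T.normalizer (CompletedCohomology k ι T ϖ i) :=
  completedCohomologyRep k ι T ϖ i

/-- `H̃^i` is a topological additive group (subspace of a product of discrete groups). [folklore] -/
instance instIsTopologicalAddGroup : IsTopologicalAddGroup (CompletedCohomology k ι T ϖ i) :=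
  inferInstance

/-- Scalar multiplication by `k` on `H̃^i` is by continuous maps. [folklore] -/
instance instContinuousConstSMul : ContinuousConstSMul k (CompletedCohomology k ι T ϖ i) :=
  ⟨fun c => continuous_induced_rng.2 (continuous_subtype_val.const_smul c)⟩

/-- The inverse-limit topology on `H̃^i` is Hausdorff. [folklore] -/
instance instT2Space : T2Space (CompletedCohomology k ι T ϖ i) :=
  inferInstance

/-- The projections `proj t : H̃^i → H̃^i(k/ϖ^t)` are continuous. [folklore] -/
theorem continuous_proj (t : ℕ) : Continuous (CompletedCohomology.proj k ι T ϖ i t) :=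
  (continuous_apply t).comp continuous_subtype_val

/-- The kernel of `proj t : H̃^i → H̃^i(k/ϖ^t)` is open. [folklore] -/
theorem isOpen_ker_proj (t : ℕ) :
    IsOpen {x : CompletedCohomology k ι T ϖ i | CompletedCohomology.proj k ι T ϖ i t x = 0} :=
  (isOpen_discrete ({0} : Set (completedCohomologyMod k ι T ϖ i t))).preimage (continuous_proj k ι T ϖ i t)

/-- A compatible sequence vanishing at stage `t'` vanishes at every earlier stage. [folklore] -/
theorem proj_eq_zero_of_le {t t' : ℕ} (h : t ≤ t') {x : CompletedCohomology k ι T ϖ i} :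
    CompletedCohomology.proj k ι T ϖ i t' x = 0 → CompletedCohomology.proj k ι T ϖ i t x = 0 := by
  induction h with
  | refl => exact id
  | @step m _ ih =>
    intro hx
    apply ih
    have hc : completedCohomologyModReduce k ι T ϖ i m (CompletedCohomology.proj k ι T ϖ i (m + 1) x) =
        CompletedCohomology.proj k ι T ϖ i m x := x.2 m
    rw [← hc, hx, map_zero]

/-- **The kernels of the projections `H̃^i → H̃^i(k/ϖ^t)` form a basis of neighbourhoods of `0`**
in the inverse-limit topology. [cite: CalegariEmerton2011, §1.1, Thm. 1.1] -/
theorem nhds_zero_hasBasis :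
    (𝓝 (0 : CompletedCohomology k ι T ϖ i)).HasBasis (fun _ : ℕ => True)
      fun t => {x | CompletedCohomology.proj k ι T ϖ i t x = 0} := by
  refine ⟨fun U => ⟨fun hU => ?_, fun ⟨t, _, ht⟩ => ?_⟩⟩
  · rw [nhds_subtype_eq_comap, nhds_pi, Filter.mem_comap] at hU
    obtain ⟨V, hV, hVU⟩ := hU
    simp only [nhds_discrete, Submodule.coe_zero] at hV
    obtain ⟨I, hI, hIV⟩ := Filter.mem_pi_pure.1 hV
    obtain ⟨N, hN⟩ := hI.bddAbove
    refine ⟨N, trivial, fun x hx => hVU (hIV _ fun t ht => ?_)⟩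
    exact proj_eq_zero_of_le k ι T ϖ i (hN ht) hx
  · exact Filter.mem_of_superset ((isOpen_ker_proj k ι T ϖ i t).mem_nhds (by simp)) ht

/-- **The action of the normaliser on `H̃^i` is by continuous maps** (each `ρ(g)` preserves the
stages). [cite: Emerton2006, §2.2, Lemma 2.2.10] -/
theorem continuous_rep (g : T.normalizer) : Continuous (rep k ι T ϖ i g) :=
  Continuous.subtype_mk (continuous_pi fun t =>
    continuous_of_discreteTopology.comp (continuous_proj k ι T ϖ i t)) _

variable {k ι T ϖ} in
/-- The Hecke operators `completedHecke` on `H̃^i` are continuous. [folklore] -/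
theorem continuous_completedHecke {g : 𝒢} (hg : IsTowerCompatible k ι T ϖ g) :
    Continuous (completedHecke hg i) :=
  Continuous.subtype_mk (continuous_pi fun t =>
    continuous_of_discreteTopology.comp (continuous_proj k ι T ϖ i t)) _

/-- `rep` followed by the projection to `H̃^i(k/ϖ^t)` (definitional). [folklore] -/
theorem proj_rep (t : ℕ) (g : T.normalizer) (x : CompletedCohomology k ι T ϖ i) :
    CompletedCohomology.proj k ι T ϖ i t (rep k ι T ϖ i g x) =
      completedCohomologyModRep k ι T ϖ i t g (CompletedCohomology.proj k ι T ϖ i t x) :=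
  rfl

end CompletedCohomology

end CompletedType

end Literature.NumberTheory.Automorphic
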